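import Literature.NumberTheory.Transcendental.FiveExponentialsAuxiliary
import HarnessLib

/-!
# The linear subgroup theorem on `𝔾ₐ × 𝔾ₘ^N` (Waldschmidt 1988, Thm 4.1), I: the auxiliary function

Topic `Literature/NumberTheory/Transcendental`. First file of a direct proof of the special case
`G = 𝔾ₐ × 𝔾ₘ^N`, `V` a hyperplane of `Lie G`, of M. Waldschmidt's linear subgroup theorem with
multiplicities [Waldschmidt1988, Thm 4.1] — the transcendence input of the strong six exponentials
theorem (`Literature.Barriers.Schanuel.roy1992_strongSixExponentials`, Roy 1992 §4 Cor. 2 =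
[Waldschmidt2005, Thm 2.1]; equivalently [Waldschmidt2005, Thm 3.1] for `d = 2`) and hence of
`Literature.NumberTheory.Transcendental.waldschmidt2005_cor_2_4/2_5/2_6`. The tree already runs this
proof in ONE configuration (`FiveExponentials*.lean`: `N = 2`, one-dimensional `W`); the present series
does it for arbitrary `N` and arbitrary `ℚ̄`-rational `W`.

This file is the analytic half of [Waldschmidt1988, §6 Prop. 6.1] in the interpolation-free form of
[Waldschmidt1981, §3] ("fonction auxiliaire générale", in tree:
`SixExponentialsSeveralVariablesAuxiliary.lean`), generalised from exponential polynomials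
`∑ p_λ e^{⟨w_λ, u⟩}` (`Waldschmidt1981.norm_expPoly_le`) to the exponential–polynomial monomials of
`𝔾ₐ × 𝔾ₘ^N` restricted to an `n + 1`-dimensional subspace with coordinates `u = (u₀, u₁, …, u_n)`
adapted to the additive coordinate (`u₀ = z`):

  `F(u) = ∑_λ p_λ · u₀^{k_λ} · e^{⟨w_λ, u⟩}`,  `k_λ < D₀`,  `‖w_{λ,i}‖ R ≤ ρ`.

* `sum_truncation_eq` — the truncation `∑_λ p_λ u₀^{k_λ} ∏ᵢ E_T(w_{λ,i}uᵢ)` (`E_T(x) = ∑_{j<T} x^j/j!`)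
  regrouped by the monomials `u₀^e ∏_m u_{m+1}^{κ_m}`, `e < D₀ + T`, `κ_m < T` — grouping by the total
  exponent `e = k_λ + j` of `u₀` (not by `(k_λ, j)`) keeps the number of linear forms at
  `(D₀ + T) Tⁿ`, which is what the parameter count of part IV needs (as in `FiveExponentialsAuxiliary`);
* `norm_coeff_mul_pow_le` — the coefficient of that monomial, scaled by `R^{e + |κ|}`, has modulus
  `≤ R^{D₀} e^{(n+1)ρ}`;
* `norm_F_le` — if all the scaled coefficient forms are `≤ ε` in modulus then
  `|F|_R ≤ (D₀+T)Tⁿ ε + #Λ · P_b · R^{D₀} (n+1) e^{(n+1)ρ} · 2e^{−T}` (sup norm on `ℂ^{n+1}`);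
* `exists_smallValues` — the box principle (`Waldschmidt1981.box_principle_complex`) then produces
  integers `p_λ`, not all zero, `|p_λ| ≤ P_b`, with `|F|_R` bounded as displayed, as soon as
  `k^{2(D₀+T)Tⁿ} < (P_b + 1)^{#Λ}`.

Everything here is PROVED; no definitions, no named facts.

## References

* [Waldschmidt1988] M. Waldschmidt, *On the transcendence methods of Gel'fond and Schneider in
  several variables*, New Advances in Transcendence Theory (A. Baker ed.), CUP 1988, 375–398, §6
  Prop. 6.1 (held scan `book:baker1988-new-advances-transcendence-theory`, pp. 310–311).
* [Waldschmidt1981] M. Waldschmidt, *Transcendance et exponentielles en plusieurs variables*,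
  Invent. Math. 63 (1981) 97–127, §3 Théorème 3.1.
* [Waldschmidt2005] M. Waldschmidt, *Variations on the six exponentials theorem*, Algebra and Number
  Theory (Hyderabad 2003), Hindustan Book Agency 2005, 338–355, Thm 2.1, Thm 3.1, Cor. 2.4–2.6.
-/

noncomputable section

open Complex Finset

namespace Literature.NumberTheory.Transcendental.LinearSubgroupGaGm

open Waldschmidt1981 (box_principle_complex norm_expPartialSum_le norm_exp_sub_partialSum_le
  norm_prod_exp_sub_prod_partialSum_le)
open Waldschmidt1988 (norm_pow_div_factorial_le_exp sum_norm_pow_div_factorial_le_exp)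

variable {Λ : Type*} [Fintype Λ] {n D₀ T : ℕ}

/-! ### Reindexing -/

/-- A sum over `Fin M` of a function supported at the value `a < M`. [folklore] -/
theorem sum_fin_ite_eq {M a : ℕ} (ha : a < M) (f : ℂ) :
    ∑ e : Fin M, (if (e : ℕ) = a then f else 0) = f := by
  rw [Finset.sum_eq_single ⟨a, ha⟩]
  · simp
  · intro b _ hb
    rw [if_neg]
    exact fun h => hb (Fin.ext h)
  · intro h
    exact absurd (Finset.mem_univ _) h

/-- Reindexing `∑_{j<T} f_j x^{k+j}` by the total exponent `e = k + j < D₀ + T` (`k < D₀`). [folklore] -/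
theorem sum_mul_pow_add_eq {k : ℕ} (hkD : k < D₀) (f : Fin T → ℂ) (x : ℂ) :
    ∑ j : Fin T, f j * x ^ (k + (j : ℕ)) =
      ∑ e : Fin (D₀ + T), (∑ j : Fin T, if (e : ℕ) = k + (j : ℕ) then f j else 0) * x ^ (e : ℕ) := by
  simp_rw [Finset.sum_mul]
  rw [Finset.sum_comm]
  refine Finset.sum_congr rfl fun j _ => ?_
  have hlt : k + (j : ℕ) < D₀ + T := by omega
  rw [← sum_fin_ite_eq hlt (f j * x ^ (k + (j : ℕ)))]
  refine Finset.sum_congr rfl fun e _ => ?_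
  split_ifs with h
  · rw [h]
  · rw [zero_mul]

/-! ### The truncation, regrouped by monomials

For `λ ∈ Λ` the truncation of `u₀^{k_λ} e^{⟨w_λ,u⟩} = u₀^{k_λ} ∏ᵢ e^{w_{λ,i} uᵢ}` at order `T` in each
variable is `u₀^{k_λ} ∏ᵢ E_T(w_{λ,i} uᵢ)`; its coefficient on `u₀^e ∏_m u_{m+1}^{κ_m}`
(`r = (e, κ) ∈ Fin (D₀+T) × (Fin n → Fin T)`) is
`q_{r,λ} = (∑_{j<T} [e = k_λ + j] w_{λ,0}^j/j!) · ∏_m w_{λ,m+1}^{κ_m}/κ_m!` (written out, no definition). -/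

/-- **The truncation regrouped by monomials**:
`∑_λ p_λ u₀^{k_λ} ∏ᵢ E_T(w_{λ,i}uᵢ) = ∑_r (∑_λ p_λ q_{r,λ}) · u₀^e ∏_m u_{m+1}^{κ_m}`. [folklore] -/
theorem sum_truncation_eq (k : Λ → ℕ) (hk : ∀ l, k l < D₀) (w : Λ → Fin (n + 1) → ℂ) (p : Λ → ℤ)
    (u : Fin (n + 1) → ℂ) :
    ∑ l, (p l : ℂ) * (u 0 ^ k l *
        ∏ i : Fin (n + 1), ∑ j : Fin T, (w l i * u i) ^ (j : ℕ) / ((j : ℕ).factorial : ℂ)) =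
      ∑ r : Fin (D₀ + T) × (Fin n → Fin T),
        (∑ l, (p l : ℂ) *
          ((∑ j : Fin T, if (r.1 : ℕ) = k l + (j : ℕ) then
              w l 0 ^ (j : ℕ) / ((j : ℕ).factorial : ℂ) else 0) *
            ∏ m : Fin n, w l m.succ ^ (r.2 m : ℕ) / ((r.2 m : ℕ).factorial : ℂ))) *
          (u 0 ^ (r.1 : ℕ) * ∏ m : Fin n, u m.succ ^ (r.2 m : ℕ)) := by
  -- each truncation, regrouped
  have hone : ∀ l, u 0 ^ k l *
      ∏ i : Fin (n + 1), ∑ j : Fin T, (w l i * u i) ^ (j : ℕ) / ((j : ℕ).factorial : ℂ) =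
      ∑ r : Fin (D₀ + T) × (Fin n → Fin T),
        ((∑ j : Fin T, if (r.1 : ℕ) = k l + (j : ℕ) then
              w l 0 ^ (j : ℕ) / ((j : ℕ).factorial : ℂ) else 0) *
            ∏ m : Fin n, w l m.succ ^ (r.2 m : ℕ) / ((r.2 m : ℕ).factorial : ℂ)) *
          (u 0 ^ (r.1 : ℕ) * ∏ m : Fin n, u m.succ ^ (r.2 m : ℕ)) := by
    intro l
    rw [Fin.prod_univ_succ, Fintype.prod_sum]
    -- the `u₀`-part
    have h0 : u 0 ^ k l * ∑ j : Fin T, (w l 0 * u 0) ^ (j : ℕ) / ((j : ℕ).factorial : ℂ) =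
        ∑ e : Fin (D₀ + T), (∑ j : Fin T, if (e : ℕ) = k l + (j : ℕ) then
          w l 0 ^ (j : ℕ) / ((j : ℕ).factorial : ℂ) else 0) * u 0 ^ (e : ℕ) := by
      rw [← sum_mul_pow_add_eq (hk l), Finset.mul_sum]
      refine Finset.sum_congr rfl fun j _ => ?_
      rw [mul_pow, pow_add]
      ring
    -- the toric part
    have h1 : ∑ κ : Fin n → Fin T, ∏ m, (w l m.succ * u m.succ) ^ (κ m : ℕ) / ((κ m : ℕ).factorial : ℂ) =
        ∑ κ : Fin n → Fin T, (∏ m, w l m.succ ^ (κ m : ℕ) / ((κ m : ℕ).factorial : ℂ)) *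
          ∏ m, u m.succ ^ (κ m : ℕ) := by
      refine Finset.sum_congr rfl fun κ _ => ?_
      rw [← Finset.prod_mul_distrib]
      refine Finset.prod_congr rfl fun m _ => ?_
      rw [mul_pow]
      ring
    rw [← mul_assoc, h0, h1, Finset.sum_mul_sum, ← Finset.univ_product_univ, Finset.sum_product]
    refine Finset.sum_congr rfl fun e _ => Finset.sum_congr rfl fun κ _ => ?_
    ring
  simp_rw [hone, Finset.mul_sum]
  rw [Finset.sum_comm]
  refine Finset.sum_congr rfl fun r _ => ?_
  rw [Finset.sum_mul]
  refine Finset.sum_congr rfl fun l _ => ?_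
  ring

/-! ### Bounds -/

omit [Fintype Λ] in
/-- **The coefficient bound**: `‖q_{r,λ}‖ · R^{e + |κ|} ≤ R^{D₀} e^{(n+1)ρ}` when `R ≥ 1`,
`‖w_{λ,i}‖ R ≤ ρ` and `k_λ < D₀`. [folklore] -/
theorem norm_coeff_mul_pow_le (k : Λ → ℕ) (hk : ∀ l, k l < D₀) (w : Λ → Fin (n + 1) → ℂ) {R ρ : ℝ}
    (hR : 1 ≤ R) (hw : ∀ l i, ‖w l i‖ * R ≤ ρ) (r : Fin (D₀ + T) × (Fin n → Fin T)) (l : Λ) :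
    ‖((∑ j : Fin T, if (r.1 : ℕ) = k l + (j : ℕ) then
          w l 0 ^ (j : ℕ) / ((j : ℕ).factorial : ℂ) else 0) *
        ∏ m : Fin n, w l m.succ ^ (r.2 m : ℕ) / ((r.2 m : ℕ).factorial : ℂ)) *
        (R : ℂ) ^ ((r.1 : ℕ) + ∑ m, (r.2 m : ℕ))‖ ≤ R ^ D₀ * Real.exp ρ ^ (n + 1) := by
  have hR0 : 0 ≤ R := zero_le_one.trans hR
  have hρ : 0 ≤ ρ := le_trans (by positivity) (hw l 0)
  have hwR : ∀ i, ‖w l i * R‖ ≤ ρ := fun i => by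
    rw [norm_mul, Complex.norm_real, Real.norm_eq_abs, abs_of_nonneg hR0]
    exact hw l i
  -- split `R^{e + |κ|}`
  have hsplit : ((∑ j : Fin T, if (r.1 : ℕ) = k l + (j : ℕ) then
          w l 0 ^ (j : ℕ) / ((j : ℕ).factorial : ℂ) else 0) *
        ∏ m : Fin n, w l m.succ ^ (r.2 m : ℕ) / ((r.2 m : ℕ).factorial : ℂ)) *
        (R : ℂ) ^ ((r.1 : ℕ) + ∑ m, (r.2 m : ℕ)) =
      (∑ j : Fin T, if (r.1 : ℕ) = k l + (j : ℕ) then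
          (w l 0 * R) ^ (j : ℕ) / ((j : ℕ).factorial : ℂ) * (R : ℂ) ^ k l else 0) *
        ∏ m : Fin n, (w l m.succ * R) ^ (r.2 m : ℕ) / ((r.2 m : ℕ).factorial : ℂ) := by
    rw [pow_add, ← Finset.prod_pow_eq_pow_sum, mul_mul_mul_comm, Finset.sum_mul,
      ← Finset.prod_mul_distrib]
    congr 1
    · refine Finset.sum_congr rfl fun j _ => ?_
      split_ifs with h
      · rw [h, pow_add, mul_pow]; ring
      · rw [zero_mul]
    · refine Finset.prod_congr rfl fun m _ => ?_
      rw [mul_pow]; ring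
  rw [hsplit, norm_mul, norm_prod]
  have h1 : ‖∑ j : Fin T, (if (r.1 : ℕ) = k l + (j : ℕ) then
            (w l 0 * R) ^ (j : ℕ) / ((j : ℕ).factorial : ℂ) * (R : ℂ) ^ k l else 0)‖ ≤
      Real.exp ρ * R ^ D₀ := by
    calc ‖∑ j : Fin T, (if (r.1 : ℕ) = k l + (j : ℕ) then
            (w l 0 * R) ^ (j : ℕ) / ((j : ℕ).factorial : ℂ) * (R : ℂ) ^ k l else 0)‖
        ≤ ∑ j : Fin T, ‖(if (r.1 : ℕ) = k l + (j : ℕ) then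
            (w l 0 * R) ^ (j : ℕ) / ((j : ℕ).factorial : ℂ) * (R : ℂ) ^ k l else 0)‖ :=
          norm_sum_le _ _
      _ ≤ ∑ j : Fin T, ‖(w l 0 * R) ^ (j : ℕ) / ((j : ℕ).factorial : ℂ)‖ * R ^ D₀ := by
          refine Finset.sum_le_sum fun j _ => ?_
          split_ifs
          · rw [norm_mul, norm_pow, Complex.norm_real, Real.norm_eq_abs, abs_of_nonneg hR0]
            exact mul_le_mul_of_nonneg_left (pow_le_pow_right₀ hR (hk l).le) (norm_nonneg _)
          · rw [norm_zero]; positivity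
      _ = (∑ j : Fin T, ‖(w l 0 * R) ^ (j : ℕ) / ((j : ℕ).factorial : ℂ)‖) * R ^ D₀ := by
          rw [Finset.sum_mul]
      _ ≤ Real.exp ρ * R ^ D₀ :=
          mul_le_mul_of_nonneg_right (sum_norm_pow_div_factorial_le_exp (hwR 0) _) (by positivity)
  have h2 : ∏ m : Fin n, ‖(w l m.succ * R) ^ (r.2 m : ℕ) / ((r.2 m : ℕ).factorial : ℂ)‖ ≤
      Real.exp ρ ^ n := by
    calc ∏ m : Fin n, ‖(w l m.succ * R) ^ (r.2 m : ℕ) / ((r.2 m : ℕ).factorial : ℂ)‖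
        ≤ ∏ _m : Fin n, Real.exp ρ :=
          Finset.prod_le_prod (fun _ _ => norm_nonneg _) fun m _ => norm_pow_div_factorial_le_exp (hwR _) _
      _ = Real.exp ρ ^ n := by rw [Finset.prod_const, Finset.card_univ, Fintype.card_fin]
  calc ‖∑ j : Fin T, (if (r.1 : ℕ) = k l + (j : ℕ) then
            (w l 0 * R) ^ (j : ℕ) / ((j : ℕ).factorial : ℂ) * (R : ℂ) ^ k l else 0)‖ *
        ∏ m : Fin n, ‖(w l m.succ * R) ^ (r.2 m : ℕ) / ((r.2 m : ℕ).factorial : ℂ)‖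
      ≤ (Real.exp ρ * R ^ D₀) * Real.exp ρ ^ n :=
        mul_le_mul h1 h2 (Finset.prod_nonneg fun _ _ => norm_nonneg _) (by positivity)
    _ = R ^ D₀ * Real.exp ρ ^ (n + 1) := by ring

/-- **The analytic half.** For `F(u) = ∑_λ p_λ u₀^{k_λ} e^{⟨w_λ, u⟩}` with `k_λ < D₀`,
`‖w_{λ,i}‖ R ≤ ρ`, `|p_λ| ≤ P_b`, `8ρ ≤ T`, `T ≥ 1`, `R ≥ 1`, and all the scaled coefficient forms
`∑_λ p_λ q_{r,λ} R^{e+|κ|}` of modulus `≤ ε`: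
`|F|_R ≤ (D₀+T)Tⁿ ε + #Λ P_b R^{D₀} (n+1)e^{(n+1)ρ} 2e^{−T}` (sup norm on `ℂ^{n+1}`). [folklore] -/
theorem norm_F_le (k : Λ → ℕ) (hk : ∀ l, k l < D₀) (w : Λ → Fin (n + 1) → ℂ) (p : Λ → ℤ)
    {R ρ ε : ℝ} (hR : 1 ≤ R) (hρ : 0 ≤ ρ) (Pb : ℕ) (hT : 8 * ρ ≤ T) (hT1 : 1 ≤ T)
    (hw : ∀ l i, ‖w l i‖ * R ≤ ρ) (hp : ∀ l, |p l| ≤ Pb)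
    (hε : ∀ r : Fin (D₀ + T) × (Fin n → Fin T),
      ‖∑ l, (p l : ℂ) * (((∑ j : Fin T, if (r.1 : ℕ) = k l + (j : ℕ) then
          w l 0 ^ (j : ℕ) / ((j : ℕ).factorial : ℂ) else 0) *
        ∏ m : Fin n, w l m.succ ^ (r.2 m : ℕ) / ((r.2 m : ℕ).factorial : ℂ)) *
        (R : ℂ) ^ ((r.1 : ℕ) + ∑ m, (r.2 m : ℕ)))‖ ≤ ε)
    (u : Fin (n + 1) → ℂ) (hu : ‖u‖ ≤ R) :
    ‖∑ l, (p l : ℂ) * (u 0 ^ k l * cexp (w l ⬝ᵥ u))‖ ≤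
      ((D₀ + T : ℕ) : ℝ) * (T : ℝ) ^ n * ε +
        Fintype.card Λ * Pb * (R ^ D₀ * ((n + 1 : ℕ) * Real.exp ρ ^ (n + 1) * (2 * Real.exp (-T)))) := by
  have hR0 : 0 ≤ R := zero_le_one.trans hR
  have hum : ∀ i, ‖u i‖ ≤ R := fun i => (norm_le_pi_norm u i).trans hu
  have ha : ∀ l i, ‖w l i * u i‖ ≤ ρ := fun l i => by
    rw [norm_mul]
    exact (mul_le_mul_of_nonneg_left (hum i) (norm_nonneg _)).trans (hw l i)
  have hexp : ∀ l, cexp (w l ⬝ᵥ u) = ∏ i, cexp (w l i * u i) := fun l => by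
    rw [dotProduct, Complex.exp_sum]
  -- the truncations
  set S : Λ → ℂ := fun l => u 0 ^ k l *
    ∏ i : Fin (n + 1), ∑ j : Fin T, (w l i * u i) ^ (j : ℕ) / ((j : ℕ).factorial : ℂ) with hS
  -- main term
  have hmain_le : ‖∑ l, (p l : ℂ) * S l‖ ≤ ((D₀ + T : ℕ) : ℝ) * (T : ℝ) ^ n * ε := by
    simp only [hS]
    rw [sum_truncation_eq k hk w p u]
    calc ‖∑ r : Fin (D₀ + T) × (Fin n → Fin T), (∑ l, (p l : ℂ) *
            ((∑ j : Fin T, if (r.1 : ℕ) = k l + (j : ℕ) then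
                w l 0 ^ (j : ℕ) / ((j : ℕ).factorial : ℂ) else 0) *
              ∏ m : Fin n, w l m.succ ^ (r.2 m : ℕ) / ((r.2 m : ℕ).factorial : ℂ))) *
            (u 0 ^ (r.1 : ℕ) * ∏ m : Fin n, u m.succ ^ (r.2 m : ℕ))‖
        ≤ ∑ r : Fin (D₀ + T) × (Fin n → Fin T), ‖(∑ l, (p l : ℂ) *
            ((∑ j : Fin T, if (r.1 : ℕ) = k l + (j : ℕ) then
                w l 0 ^ (j : ℕ) / ((j : ℕ).factorial : ℂ) else 0) *
              ∏ m : Fin n, w l m.succ ^ (r.2 m : ℕ) / ((r.2 m : ℕ).factorial : ℂ))) *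
            (u 0 ^ (r.1 : ℕ) * ∏ m : Fin n, u m.succ ^ (r.2 m : ℕ))‖ := norm_sum_le _ _
      _ ≤ ∑ _r : Fin (D₀ + T) × (Fin n → Fin T), ε := by
          refine Finset.sum_le_sum fun r _ => ?_
          refine le_trans ?_ (hε r)
          have hfac : ∑ l, (p l : ℂ) * (((∑ j : Fin T, if (r.1 : ℕ) = k l + (j : ℕ) then
                w l 0 ^ (j : ℕ) / ((j : ℕ).factorial : ℂ) else 0) *
              ∏ m : Fin n, w l m.succ ^ (r.2 m : ℕ) / ((r.2 m : ℕ).factorial : ℂ)) *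
              (R : ℂ) ^ ((r.1 : ℕ) + ∑ m, (r.2 m : ℕ))) =
              (∑ l, (p l : ℂ) * ((∑ j : Fin T, if (r.1 : ℕ) = k l + (j : ℕ) then
                w l 0 ^ (j : ℕ) / ((j : ℕ).factorial : ℂ) else 0) *
              ∏ m : Fin n, w l m.succ ^ (r.2 m : ℕ) / ((r.2 m : ℕ).factorial : ℂ))) *
              (R : ℂ) ^ ((r.1 : ℕ) + ∑ m, (r.2 m : ℕ)) := by
            rw [Finset.sum_mul]
            refine Finset.sum_congr rfl fun l _ => ?_
            ring
          have hmono : ‖u 0 ^ (r.1 : ℕ) * ∏ m : Fin n, u m.succ ^ (r.2 m : ℕ)‖ ≤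
              R ^ ((r.1 : ℕ) + ∑ m, (r.2 m : ℕ)) := by
            rw [norm_mul, norm_pow, norm_prod, pow_add, ← Finset.prod_pow_eq_pow_sum]
            refine mul_le_mul (pow_le_pow_left₀ (norm_nonneg _) (hum 0) _) ?_ (by positivity)
              (by positivity)
            exact Finset.prod_le_prod (fun _ _ => norm_nonneg _) fun m _ => by
              rw [norm_pow]
              exact pow_le_pow_left₀ (norm_nonneg _) (hum _) _
          rw [hfac]
          set A : ℂ := ∑ l, (p l : ℂ) * ((∑ j : Fin T, if (r.1 : ℕ) = k l + (j : ℕ) then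
                w l 0 ^ (j : ℕ) / ((j : ℕ).factorial : ℂ) else 0) *
              ∏ m : Fin n, w l m.succ ^ (r.2 m : ℕ) / ((r.2 m : ℕ).factorial : ℂ)) with hA
          calc ‖A * (u 0 ^ (r.1 : ℕ) * ∏ m : Fin n, u m.succ ^ (r.2 m : ℕ))‖
              = ‖A‖ * ‖u 0 ^ (r.1 : ℕ) * ∏ m : Fin n, u m.succ ^ (r.2 m : ℕ)‖ := norm_mul _ _
            _ ≤ ‖A‖ * R ^ ((r.1 : ℕ) + ∑ m, (r.2 m : ℕ)) :=
                mul_le_mul_of_nonneg_left hmono (norm_nonneg _)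
            _ = ‖A * (R : ℂ) ^ ((r.1 : ℕ) + ∑ m, (r.2 m : ℕ))‖ := by
                rw [norm_mul, norm_pow, Complex.norm_real, Real.norm_eq_abs, abs_of_nonneg hR0]
      _ = ((D₀ + T : ℕ) : ℝ) * (T : ℝ) ^ n * ε := by
          rw [Finset.sum_const, Finset.card_univ, Fintype.card_prod, Fintype.card_pi,
            Finset.prod_const, Fintype.card_fin, Finset.card_univ, Fintype.card_fin, Fintype.card_fin,
            nsmul_eq_mul]
          push_cast
          ring
  -- remainder
  have hrem_le : ‖∑ l, (p l : ℂ) * (u 0 ^ k l * cexp (w l ⬝ᵥ u)) - ∑ l, (p l : ℂ) * S l‖ ≤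
      Fintype.card Λ * Pb * (R ^ D₀ * ((n + 1 : ℕ) * Real.exp ρ ^ (n + 1) * (2 * Real.exp (-T)))) := by
    rw [← Finset.sum_sub_distrib]
    calc ‖∑ l, ((p l : ℂ) * (u 0 ^ k l * cexp (w l ⬝ᵥ u)) - (p l : ℂ) * S l)‖
        ≤ ∑ l, ‖(p l : ℂ) * (u 0 ^ k l * cexp (w l ⬝ᵥ u)) - (p l : ℂ) * S l‖ := norm_sum_le _ _
      _ ≤ ∑ _l : Λ, (Pb : ℝ) * (R ^ D₀ * ((n + 1 : ℕ) * Real.exp ρ ^ (n + 1) * (2 * Real.exp (-T)))) :=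
          Finset.sum_le_sum fun l _ => by
            rw [← mul_sub, norm_mul, hexp l, hS]
            simp only
            rw [← mul_sub, norm_mul]
            refine mul_le_mul ?_ (mul_le_mul ?_ ?_ (norm_nonneg _) (by positivity)) (by positivity)
              (Nat.cast_nonneg _)
            · rw [Complex.norm_intCast]; exact_mod_cast hp l
            · rw [norm_pow]
              exact (pow_le_pow_left₀ (norm_nonneg _) (hum 0) _).trans (pow_le_pow_right₀ hR (hk l).le)
            · have := norm_prod_exp_sub_prod_partialSum_le (Finset.univ : Finset (Fin (n + 1)))
                (fun i => w l i * u i) hρ (fun i _ => ha l i) hT hT1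
              simpa only [Finset.card_univ, Fintype.card_fin] using this
      _ = Fintype.card Λ * Pb * (R ^ D₀ * ((n + 1 : ℕ) * Real.exp ρ ^ (n + 1) * (2 * Real.exp (-T)))) := by
          rw [Finset.sum_const, Finset.card_univ, nsmul_eq_mul]; ring
  calc ‖∑ l, (p l : ℂ) * (u 0 ^ k l * cexp (w l ⬝ᵥ u))‖
      = ‖∑ l, (p l : ℂ) * S l +
          (∑ l, (p l : ℂ) * (u 0 ^ k l * cexp (w l ⬝ᵥ u)) - ∑ l, (p l : ℂ) * S l)‖ := by
        congr 1; ring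
    _ ≤ ‖∑ l, (p l : ℂ) * S l‖ +
          ‖∑ l, (p l : ℂ) * (u 0 ^ k l * cexp (w l ⬝ᵥ u)) - ∑ l, (p l : ℂ) * S l‖ := norm_add_le _ _
    _ ≤ _ := add_le_add hmain_le hrem_le

/-- **The auxiliary function** ([Waldschmidt1988, Prop. 6.1], analytic half, in the
interpolation-free form of [Waldschmidt1981, Thm 3.1]). With `k_λ < D₀`, `‖w_{λ,i}‖ R ≤ ρ`, `R ≥ 1`,
`8ρ ≤ T`, `T ≥ 1` and the box-principle count `k^{2(D₀+T)Tⁿ} < (P_b + 1)^{#Λ}`, there are integers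
`p_λ`, not all zero, `|p_λ| ≤ P_b`, such that
`F(u) = ∑_λ p_λ u₀^{k_λ} e^{⟨w_λ,u⟩}` satisfies, for `‖u‖ ≤ R` (sup norm on `ℂ^{n+1}`),
`|F(u)| ≤ (D₀+T)Tⁿ · 2(2 #Λ R^{D₀}e^{(n+1)ρ} P_b + 1)/k + #Λ P_b R^{D₀} (n+1) e^{(n+1)ρ} 2e^{−T}`.
[cite: Waldschmidt1988, §6 Prop. 6.1] [cite: Waldschmidt1981, §3 Thm 3.1] -/
theorem exists_smallValues (k : Λ → ℕ) (hk : ∀ l, k l < D₀) (w : Λ → Fin (n + 1) → ℂ)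
    {R ρ : ℝ} (hR : 1 ≤ R) (hρ : 0 ≤ ρ) (hw : ∀ l i, ‖w l i‖ * R ≤ ρ)
    (hT : 8 * ρ ≤ T) (hT1 : 1 ≤ T) (Pb k₀ : ℕ) (hk₀ : 0 < k₀)
    (hcard : k₀ ^ (2 * ((D₀ + T) * T ^ n)) < (Pb + 1) ^ Fintype.card Λ) :
    ∃ p : Λ → ℤ, p ≠ 0 ∧ (∀ l, |p l| ≤ Pb) ∧
      ∀ u : Fin (n + 1) → ℂ, ‖u‖ ≤ R →
        ‖∑ l, (p l : ℂ) * (u 0 ^ k l * cexp (w l ⬝ᵥ u))‖ ≤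
          ((D₀ + T : ℕ) : ℝ) * (T : ℝ) ^ n *
              (2 * ((2 * Fintype.card Λ * (R ^ D₀ * Real.exp ρ ^ (n + 1)) * Pb + 1) / k₀)) +
            Fintype.card Λ * Pb *
              (R ^ D₀ * ((n + 1 : ℕ) * Real.exp ρ ^ (n + 1) * (2 * Real.exp (-T)))) := by
  classical
  -- the matrix of the scaled coefficient forms
  set a : (Fin (D₀ + T) × (Fin n → Fin T)) → Λ → ℂ := fun r l =>
    ((∑ j : Fin T, if (r.1 : ℕ) = k l + (j : ℕ) then
          w l 0 ^ (j : ℕ) / ((j : ℕ).factorial : ℂ) else 0) *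
        ∏ m : Fin n, w l m.succ ^ (r.2 m : ℕ) / ((r.2 m : ℕ).factorial : ℂ)) *
        (R : ℂ) ^ ((r.1 : ℕ) + ∑ m, (r.2 m : ℕ)) with ha_def
  have hA0 : 0 ≤ R ^ D₀ * Real.exp ρ ^ (n + 1) := by positivity
  have hA : ∀ r l, ‖a r l‖ ≤ R ^ D₀ * Real.exp ρ ^ (n + 1) := fun r l =>
    norm_coeff_mul_pow_le k hk w hR hw r l
  have hcard' : k₀ ^ (2 * Fintype.card (Fin (D₀ + T) × (Fin n → Fin T))) <
      (Pb + 1) ^ Fintype.card Λ := by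
    simpa only [Fintype.card_prod, Fintype.card_pi, Finset.prod_const, Fintype.card_fin,
      Finset.card_univ] using hcard
  obtain ⟨p, hp0, hpP, hpL⟩ := box_principle_complex a hA0 hA Pb k₀ hk₀ hcard'
  refine ⟨p, hp0, hpP, fun u hu => ?_⟩
  exact norm_F_le k hk w p hR hρ Pb hT hT1 hw hpP (fun r => hpL r) u hu

end Literature.NumberTheory.Transcendental.LinearSubgroupGaGm

end
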